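import Literature.NumberTheory.Transcendental.Associators
import Literature.NumberTheory.Transcendental.KZCubicalCalculus
import Literature.NumberTheory.Transcendental.NashCubes
import Literature.NumberTheory.Transcendental.SemialgebraicLineDeriv

/-!
# `PentagonInKZ`, line `edge-normal-newton-leibniz`: corner engine — bounds for the transport `B` (existence of `Q a`, `E a`, part 1)

Helper file for the proof of `cornerEngine_uniformlyNull` (crux `FurushoPentagon.PentagonInKZ`,
stmt-KontsevichZagierPeriods-11348), in the ABSTRACT ENGINE signature (hypothesised dictionaries and
one hypothesis bundle `H`, byte-identical with the other engine files).  Step A of the engine needs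
the height differences `Q a = ρ [fd_a(Ξ₁,Η₁) B^{μ∘op a}(Ξ₁,Η₁) − fd_a(Ξ₁,0) B^{μ∘op a}(Ξ₁,0)]` and
the level-`(n−2)` terms `E a` as honest representations, i.e. their integrands must be bounded on
the open cube.  This file proves the analytic input, the **master bound** `qe_master_bound`: for
`x` in the closed and `y` in the OPEN cube, `0 < ξ ≤ α`, `η, η' ∈ [0, β]`,
`|fd_a(ξ,η')| · |B^{μ∘op a}(ξ,η) − B^{μ∘op a}(ξ,0)| ≤ K η` and
`|fd_a(ξ,η) B(ξ,η) − fd_a(ξ,0) B(ξ,0)| ≤ K η`, uniformly.  For the regularised letter `a = ℓ`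
(weight `1/ξ`) this rests on `B^{μ∘ad Z_ℓ} = O(ξ η)`: from `Ht = O(ξ)` in positive horizontal
length, and in horizontal length `0` from the CENTRALITY of `Z_ℓ` against the vertical edge
transport (`Σ_V μ([Z_ℓ, wZ V]) Vt_V(y; 0, η) = 0`, hypothesis `hcentV`) together with the
`η`-Lipschitz bound of `Vt` in the dilation.

References: [Drinfeld1991, §2] (the corner argument), [KontsevichZagier2001, §1.1].
-/

noncomputable section

open Set MeasureTheory
open Literature.NumberTheory.Transcendental
open Literature.ModelTheory.ExponentialFields (IsSemialgebraic)

namespace Summit.KontsevichZagierPeriods.FurushoPentagon.PentagonInKZ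

section AbstractEngine

variable {m N : ℕ} {ℓ ℓ' : Fin (m + 2)} {α β : ℚ}
  {Zq : Fin (m + 2) → (DrinfeldKohnoTrunc ℚ (Fin 4) N)} {wZ : ∀ {n : ℕ}, (Fin n → Fin (m + 2)) → (DrinfeldKohnoTrunc ℚ (Fin 4) N)}
  {fd gd dd : Fin (m + 2) → ℝ → ℝ → ℝ}
  {Ht Vt dHt dVt : ∀ {n : ℕ}, (Fin n → Fin (m + 2)) → (Fin n → ℝ) → ℝ → ℝ → ℝ}
  {op opV : Fin (m + 2) → (DrinfeldKohnoTrunc ℚ (Fin 4) N) →ₗ[ℚ] (DrinfeldKohnoTrunc ℚ (Fin 4) N)}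
  {Af Bf dAf dBf F : ((DrinfeldKohnoTrunc ℚ (Fin 4) N) →ₗ[ℚ] ℚ) → ∀ {k l : ℕ}, (Fin k → ℝ) → (Fin l → ℝ) → ℝ → ℝ → ℝ}
  {Xb : ∀ k l e : ℕ, (Fin (k + l + e) → ℝ) → Fin k → ℝ}
  {Yb : ∀ k l e : ℕ, (Fin (k + l + e) → ℝ) → Fin l → ℝ}
  {Θb : ∀ k l e : ℕ, (Fin (k + l + e) → ℝ) → Fin e → ℝ}

variable (H :
    (∀ {n : ℕ} (U : Fin n → Fin (m + 2)), wZ U = ((List.ofFn U).map Zq).prod) ∧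
    (∀ (a : Fin (m + 2)) (X : (DrinfeldKohnoTrunc ℚ (Fin 4) N)), op a X = if a = ℓ then Zq ℓ * X - X * Zq ℓ else Zq a * X) ∧
    (∀ (b : Fin (m + 2)) (X : (DrinfeldKohnoTrunc ℚ (Fin 4) N)), opV b X = if b = ℓ' then Zq ℓ' * X - X * Zq ℓ' else Zq b * X) ∧
    (∀ (μ : (DrinfeldKohnoTrunc ℚ (Fin 4) N) →ₗ[ℚ] ℚ) {k l : ℕ} (x : Fin k → ℝ) (y : Fin l → ℝ) (ξ η : ℝ), Af μ x y ξ η = ∑ U : Fin k → Fin (m + 2), ∑ V : Fin l → Fin (m + 2), (μ (wZ U * wZ V) : ℝ) * (Ht U x ξ η * Vt V y 0 η)) ∧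
    (∀ (μ : (DrinfeldKohnoTrunc ℚ (Fin 4) N) →ₗ[ℚ] ℚ) {k l : ℕ} (x : Fin k → ℝ) (y : Fin l → ℝ) (ξ η : ℝ), Bf μ x y ξ η = ∑ U : Fin k → Fin (m + 2), ∑ V : Fin l → Fin (m + 2), (μ (wZ V * wZ U) : ℝ) * (Vt V y ξ η * Ht U x ξ 0)) ∧
    (∀ (μ : (DrinfeldKohnoTrunc ℚ (Fin 4) N) →ₗ[ℚ] ℚ) {k l : ℕ} (x : Fin k → ℝ) (y : Fin l → ℝ) (ξ η : ℝ), dAf μ x y ξ η = ∑ U : Fin k → Fin (m + 2), ∑ V : Fin l → Fin (m + 2), (μ (wZ U * wZ V) : ℝ) * (dHt U x ξ η * Vt V y 0 η)) ∧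
    (∀ (μ : (DrinfeldKohnoTrunc ℚ (Fin 4) N) →ₗ[ℚ] ℚ) {k l : ℕ} (x : Fin k → ℝ) (y : Fin l → ℝ) (ξ η : ℝ), dBf μ x y ξ η = ∑ U : Fin k → Fin (m + 2), ∑ V : Fin l → Fin (m + 2), (μ (wZ V * wZ U) : ℝ) * (dVt V y ξ η * Ht U x ξ 0)) ∧
    (∀ (μ : (DrinfeldKohnoTrunc ℚ (Fin 4) N) →ₗ[ℚ] ℚ) {k l : ℕ} (x : Fin k → ℝ) (y : Fin l → ℝ) (ξ η : ℝ), F μ x y ξ η = Af μ x y ξ η - Bf μ x y ξ η) ∧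
    (∀ (k l e : ℕ) (z : Fin (k + l + e) → ℝ), Xb k l e z = fun i => z (Fin.castAdd e (Fin.castAdd l i))) ∧
    (∀ (k l e : ℕ) (z : Fin (k + l + e) → ℝ), Yb k l e z = fun j => z (Fin.castAdd e (Fin.natAdd k j))) ∧
    (∀ (k l e : ℕ) (z : Fin (k + l + e) → ℝ), Θb k l e z = fun s => z (Fin.natAdd (k + l) s)) ∧
    (∀ (U : Fin 0 → Fin (m + 2)) (x : Fin 0 → ℝ) (ξ η : ℝ), Ht U x ξ η = 1) ∧
    (∀ (V : Fin 0 → Fin (m + 2)) (y : Fin 0 → ℝ) (ξ η : ℝ), Vt V y ξ η = 1) ∧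
    (∀ (U : Fin 0 → Fin (m + 2)) (x : Fin 0 → ℝ) (ξ η : ℝ), dHt U x ξ η = 0) ∧
    (∀ (V : Fin 0 → Fin (m + 2)) (y : Fin 0 → ℝ) (ξ η : ℝ), dVt V y ξ η = 0) ∧
    (∀ {k : ℕ} (U : Fin (k + 1) → Fin (m + 2)) (x : Fin (k + 1) → ℝ) (η : ℝ), Ht U x 0 η = 0) ∧
    (∀ {l : ℕ} (V : Fin (l + 1) → Fin (m + 2)) (y : Fin (l + 1) → ℝ) (ξ : ℝ), Vt V y ξ 0 = 0) ∧
    (∀ t y : ℝ, fd ℓ t y = 1 / t) ∧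
    (∀ x s : ℝ, gd ℓ' x s = 1 / s) ∧
    (∀ x y : ℝ, dd ℓ x y = 0) ∧
    (∀ x y : ℝ, dd ℓ' x y = 0) ∧
    (∀ (μ : (DrinfeldKohnoTrunc ℚ (Fin 4) N) →ₗ[ℚ] ℚ) {k : ℕ} (x₀ : ℝ) (x' : Fin k → ℝ) (ξ η : ℝ), ∑ U : Fin (k + 1) → Fin (m + 2), (μ (wZ U) : ℝ) * Ht U (Fin.cons x₀ x') ξ η = (∑ a : Fin (m + 2), (if a = ℓ then 1 / x₀ else ξ * fd a (ξ * x₀) η) * ∑ U' : Fin k → Fin (m + 2), (μ (Zq a * wZ U') : ℝ) * Ht U' x' (ξ * x₀) η) - (1 / x₀) * ∑ U' : Fin k → Fin (m + 2), (μ (wZ U' * Zq ℓ) : ℝ) * Ht U' x' (ξ * x₀) η) ∧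
    (∀ (μ : (DrinfeldKohnoTrunc ℚ (Fin 4) N) →ₗ[ℚ] ℚ) {l : ℕ} (y₀ : ℝ) (y' : Fin l → ℝ) (ξ η : ℝ), ∑ V : Fin (l + 1) → Fin (m + 2), (μ (wZ V) : ℝ) * Vt V (Fin.cons y₀ y') ξ η = (∑ b : Fin (m + 2), (if b = ℓ' then 1 / y₀ else η * gd b ξ (η * y₀)) * ∑ V' : Fin l → Fin (m + 2), (μ (Zq b * wZ V') : ℝ) * Vt V' y' ξ (η * y₀)) - (1 / y₀) * ∑ V' : Fin l → Fin (m + 2), (μ (wZ V' * Zq ℓ') : ℝ) * Vt V' y' ξ (η * y₀)) ∧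
    (∀ (μ : (DrinfeldKohnoTrunc ℚ (Fin 4) N) →ₗ[ℚ] ℚ) {l : ℕ} (P Q : (DrinfeldKohnoTrunc ℚ (Fin 4) N)) (y : Fin l → ℝ) (η : ℝ), (∀ i, 0 < y i ∧ y i < 1) → 0 < η → η ≤ (β : ℝ) → ∑ V : Fin l → Fin (m + 2), (μ (P * (Zq ℓ * wZ V - wZ V * Zq ℓ) * Q) : ℝ) * Vt V y 0 η = 0) ∧
    (∀ (μ : (DrinfeldKohnoTrunc ℚ (Fin 4) N) →ₗ[ℚ] ℚ) {k : ℕ} (P Q : (DrinfeldKohnoTrunc ℚ (Fin 4) N)) (x : Fin k → ℝ) (ξ : ℝ), (∀ i, 0 < x i ∧ x i < 1) → 0 < ξ → ξ ≤ (α : ℝ) → ∑ U : Fin k → Fin (m + 2), (μ (P * (Zq ℓ' * wZ U - wZ U * Zq ℓ') * Q) : ℝ) * Ht U x ξ 0 = 0) ∧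
    (∀ (μ : (DrinfeldKohnoTrunc ℚ (Fin 4) N) →ₗ[ℚ] ℚ) (P Q : (DrinfeldKohnoTrunc ℚ (Fin 4) N)), μ (P * (Zq ℓ * Zq ℓ' - Zq ℓ' * Zq ℓ) * Q) = 0) ∧
    (∀ (μ : (DrinfeldKohnoTrunc ℚ (Fin 4) N) →ₗ[ℚ] ℚ) (P Q : (DrinfeldKohnoTrunc ℚ (Fin 4) N)) (x y : ℝ), 0 < x → x < (α : ℝ) → 0 < y → y < (β : ℝ) → ∑ a : Fin (m + 2), ∑ b : Fin (m + 2), (fd a x y * gd b x y) * (μ (P * (Zq a * Zq b - Zq b * Zq a) * Q) : ℝ) = 0) ∧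
    (∀ (μ : (DrinfeldKohnoTrunc ℚ (Fin 4) N) →ₗ[ℚ] ℚ) (P Q : (DrinfeldKohnoTrunc ℚ (Fin 4) N)) (s : ℝ), 0 < s → s < (β : ℝ) → ∑ b : Fin (m + 2), gd b 0 s * (μ (P * (Zq ℓ * Zq b - Zq b * Zq ℓ) * Q) : ℝ) = 0) ∧
    (∀ (μ : (DrinfeldKohnoTrunc ℚ (Fin 4) N) →ₗ[ℚ] ℚ) (P Q : (DrinfeldKohnoTrunc ℚ (Fin 4) N)) (t : ℝ), 0 < t → t < (α : ℝ) → ∑ a : Fin (m + 2), fd a t 0 * (μ (P * (Zq ℓ' * Zq a - Zq a * Zq ℓ') * Q) : ℝ) = 0) ∧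
    (∀ (a : Fin (m + 2)) (ξ η : ℝ), 0 ≤ ξ → ξ ≤ (α : ℝ) → 0 ≤ η → η ≤ (β : ℝ) → HasDerivAt (fun y => fd a ξ y) (dd a ξ η) η) ∧
    (∀ (b : Fin (m + 2)) (ξ η : ℝ), 0 ≤ ξ → ξ ≤ (α : ℝ) → 0 ≤ η → η ≤ (β : ℝ) → HasDerivAt (fun x => gd b x η) (dd b ξ η) ξ) ∧
    (∀ {k : ℕ} (U : Fin k → Fin (m + 2)) (x : Fin k → ℝ) (ξ η : ℝ), (∀ i, 0 ≤ x i ∧ x i ≤ 1) → 0 ≤ ξ → ξ ≤ (α : ℝ) → 0 ≤ η → η ≤ (β : ℝ) → HasDerivAt (fun t => Ht U x t η) (dHt U x ξ η) ξ) ∧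
    (∀ {l : ℕ} (V : Fin l → Fin (m + 2)) (y : Fin l → ℝ) (ξ η : ℝ), (∀ i, 0 ≤ y i ∧ y i ≤ 1) → 0 ≤ ξ → ξ ≤ (α : ℝ) → 0 ≤ η → η ≤ (β : ℝ) → HasDerivAt (fun s => Vt V y ξ s) (dVt V y ξ η) η) ∧
    (∀ {k : ℕ} (U : Fin (k + 1) → Fin (m + 2)) (x₀ : ℝ) (x' : Fin k → ℝ) (ξ η : ℝ), 0 < x₀ → x₀ < 1 → (∀ i, 0 ≤ x' i ∧ x' i ≤ 1) → 0 ≤ ξ → ξ ≤ (α : ℝ) → 0 ≤ η → η ≤ (β : ℝ) → HasDerivAt (fun t => t * Ht U (Fin.cons t x') ξ η) (ξ * dHt U (Fin.cons x₀ x') ξ η) x₀) ∧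
    (∀ {l : ℕ} (V : Fin (l + 1) → Fin (m + 2)) (y₀ : ℝ) (y' : Fin l → ℝ) (ξ η : ℝ), 0 < y₀ → y₀ < 1 → (∀ i, 0 ≤ y' i ∧ y' i ≤ 1) → 0 ≤ ξ → ξ ≤ (α : ℝ) → 0 ≤ η → η ≤ (β : ℝ) → HasDerivAt (fun t => t * Vt V (Fin.cons t y') ξ η) (η * dVt V (Fin.cons y₀ y') ξ η) y₀) ∧
    (∀ {k : ℕ} (U : Fin (k + 1) → Fin (m + 2)) (x' : Fin k → ℝ) (ξ η : ℝ), (∀ i, 0 ≤ x' i ∧ x' i ≤ 1) → 0 ≤ ξ → ξ ≤ (α : ℝ) → 0 ≤ η → η ≤ (β : ℝ) → ContinuousOn (fun t => t * Ht U (Fin.cons t x') ξ η) (Set.Icc 0 1)) ∧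
    (∀ {l : ℕ} (V : Fin (l + 1) → Fin (m + 2)) (y' : Fin l → ℝ) (ξ η : ℝ), (∀ i, 0 ≤ y' i ∧ y' i ≤ 1) → 0 ≤ ξ → ξ ≤ (α : ℝ) → 0 ≤ η → η ≤ (β : ℝ) → ContinuousOn (fun t => t * Vt V (Fin.cons t y') ξ η) (Set.Icc 0 1)) ∧
    (∀ {d : ℕ} {W : Set (Fin d → ℝ)}, IsSemialgebraic ℚ W → ∀ (a : Fin (m + 2)) {T Y : (Fin d → ℝ) → ℝ}, IsSemialgebraicFunOn ℚ W T → IsSemialgebraicFunOn ℚ W Y → IsSemialgebraicFunOn ℚ W fun z => fd a (T z) (Y z)) ∧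
    (∀ {d : ℕ} {W : Set (Fin d → ℝ)}, IsSemialgebraic ℚ W → ∀ (b : Fin (m + 2)) {T Y : (Fin d → ℝ) → ℝ}, IsSemialgebraicFunOn ℚ W T → IsSemialgebraicFunOn ℚ W Y → IsSemialgebraicFunOn ℚ W fun z => gd b (T z) (Y z)) ∧
    (∀ {d : ℕ} {W : Set (Fin d → ℝ)}, IsSemialgebraic ℚ W → ∀ (a : Fin (m + 2)) {T Y : (Fin d → ℝ) → ℝ}, IsSemialgebraicFunOn ℚ W T → IsSemialgebraicFunOn ℚ W Y → IsSemialgebraicFunOn ℚ W fun z => dd a (T z) (Y z)) ∧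
    (∀ {d : ℕ} {W : Set (Fin d → ℝ)}, IsSemialgebraic ℚ W → ∀ {n : ℕ} (U : Fin n → Fin (m + 2)) {X : (Fin d → ℝ) → Fin n → ℝ} {P Q : (Fin d → ℝ) → ℝ}, (∀ i, IsSemialgebraicFunOn ℚ W fun z => X z i) → IsSemialgebraicFunOn ℚ W P → IsSemialgebraicFunOn ℚ W Q → IsSemialgebraicFunOn ℚ W fun z => Ht U (X z) (P z) (Q z)) ∧
    (∀ {d : ℕ} {W : Set (Fin d → ℝ)}, IsSemialgebraic ℚ W → ∀ {n : ℕ} (V : Fin n → Fin (m + 2)) {Y : (Fin d → ℝ) → Fin n → ℝ} {P Q : (Fin d → ℝ) → ℝ}, (∀ i, IsSemialgebraicFunOn ℚ W fun z => Y z i) → IsSemialgebraicFunOn ℚ W P → IsSemialgebraicFunOn ℚ W Q → IsSemialgebraicFunOn ℚ W fun z => Vt V (Y z) (P z) (Q z)) ∧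
    (∀ {d : ℕ} {W : Set (Fin d → ℝ)}, IsSemialgebraic ℚ W → ∀ {n : ℕ} (U : Fin n → Fin (m + 2)) {X : (Fin d → ℝ) → Fin n → ℝ} {P Q : (Fin d → ℝ) → ℝ}, (∀ i, IsSemialgebraicFunOn ℚ W fun z => X z i) → IsSemialgebraicFunOn ℚ W P → IsSemialgebraicFunOn ℚ W Q → IsSemialgebraicFunOn ℚ W fun z => dHt U (X z) (P z) (Q z)) ∧
    (∀ {d : ℕ} {W : Set (Fin d → ℝ)}, IsSemialgebraic ℚ W → ∀ {n : ℕ} (V : Fin n → Fin (m + 2)) {Y : (Fin d → ℝ) → Fin n → ℝ} {P Q : (Fin d → ℝ) → ℝ}, (∀ i, IsSemialgebraicFunOn ℚ W fun z => Y z i) → IsSemialgebraicFunOn ℚ W P → IsSemialgebraicFunOn ℚ W Q → IsSemialgebraicFunOn ℚ W fun z => dVt V (Y z) (P z) (Q z)) ∧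
    (∃ C : ℝ, ∀ (a : Fin (m + 2)) (ξ η : ℝ), 0 ≤ ξ → ξ ≤ (α : ℝ) → 0 ≤ η → η ≤ (β : ℝ) → (a ≠ ℓ → |fd a ξ η| ≤ C) ∧ (a ≠ ℓ' → |gd a ξ η| ≤ C) ∧ |dd a ξ η| ≤ C ∧ (∀ η' : ℝ, 0 ≤ η' → η' ≤ (β : ℝ) → |fd a ξ η - fd a ξ η'| ≤ C * |η - η'|) ∧ (∀ ξ' : ℝ, 0 ≤ ξ' → ξ' ≤ (α : ℝ) → |gd a ξ η - gd a ξ' η| ≤ C * |ξ - ξ'|)) ∧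
    (∀ k : ℕ, ∃ C : ℝ, ∀ (U : Fin k → Fin (m + 2)) (x : Fin k → ℝ) (ξ η : ℝ), (∀ i, 0 ≤ x i ∧ x i ≤ 1) → 0 ≤ ξ → ξ ≤ (α : ℝ) → 0 ≤ η → η ≤ (β : ℝ) → |Ht U x ξ η| ≤ C ∧ |dHt U x ξ η| ≤ C ∧ (0 < k → |Ht U x ξ η| ≤ C * ξ) ∧ (∀ η' : ℝ, 0 ≤ η' → η' ≤ (β : ℝ) → |Ht U x ξ η - Ht U x ξ η'| ≤ C * ξ * |η - η'|)) ∧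
    (∀ l : ℕ, ∃ C : ℝ, ∀ (V : Fin l → Fin (m + 2)) (y : Fin l → ℝ) (ξ η : ℝ), (∀ i, 0 ≤ y i ∧ y i ≤ 1) → 0 ≤ ξ → ξ ≤ (α : ℝ) → 0 ≤ η → η ≤ (β : ℝ) → |Vt V y ξ η| ≤ C ∧ |dVt V y ξ η| ≤ C ∧ (0 < l → |Vt V y ξ η| ≤ C * η) ∧ (∀ ξ' : ℝ, 0 ≤ ξ' → ξ' ≤ (α : ℝ) → |Vt V y ξ η - Vt V y ξ' η| ≤ C * η * |ξ - ξ'|)))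

/-! ### Existence of `Q a` and `E a` (worker QE): elementary tools -/

/-- **A weighted double sum is bounded by the total mass of its coefficients**:
`|Σ_U Σ_V c_{UV} f_V g_U| ≤ (Σ_U Σ_V |c_{UV}|) · B₁ · B₂` whenever `|f| ≤ B₁`, `|g| ≤ B₂`.
[folklore] -/
theorem qe_abs_sum_sum_le {ι κ : Type*} [Fintype ι] [Fintype κ] (c : ι → κ → ℝ) (f : κ → ℝ)
    (g : ι → ℝ) {B₁ B₂ : ℝ} (hf : ∀ V, |f V| ≤ B₁) (hg : ∀ U, |g U| ≤ B₂) :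
    |∑ U, ∑ V, c U V * (f V * g U)| ≤ (∑ U, ∑ V, |c U V|) * B₁ * B₂ := by
  calc |∑ U, ∑ V, c U V * (f V * g U)|
      ≤ ∑ U, |∑ V, c U V * (f V * g U)| := Finset.abs_sum_le_sum_abs _ _
    _ ≤ ∑ U, ∑ V, |c U V| * (B₁ * B₂) := by
        refine Finset.sum_le_sum fun U _ =>
          (Finset.abs_sum_le_sum_abs _ _).trans (Finset.sum_le_sum fun V _ => ?_)
        rw [abs_mul, abs_mul]
        exact mul_le_mul_of_nonneg_left
          (mul_le_mul (hf V) (hg U) (abs_nonneg _) ((abs_nonneg _).trans (hf V))) (abs_nonneg _)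
    _ = (∑ U, ∑ V, |c U V|) * B₁ * B₂ := by
        rw [Finset.sum_mul, Finset.sum_mul]
        refine Finset.sum_congr rfl fun U _ => ?_
        rw [Finset.sum_mul, Finset.sum_mul]
        exact Finset.sum_congr rfl fun V _ => by ring

include H in
/-- The residue monomial of the empty word is `1` (worker copy). [folklore] -/
theorem qe_wZ_nil (U : Fin 0 → Fin (m + 2)) : wZ U = 1 := by
  obtain ⟨hwZ, -⟩ := H
  rw [hwZ, List.ofFn_zero, List.map_nil, List.prod_nil]

include H in
/-- The coordinate blocks of a point of the open cube lie in open cubes (worker copy). [folklore] -/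
theorem qe_blocks_mem_open {k l e : ℕ} {z : Fin (k + l + e) → ℝ} (hz : z ∈ openUnitCube (k + l + e)) :
    (∀ i, 0 < Xb k l e z i ∧ Xb k l e z i < 1) ∧ (∀ j, 0 < Yb k l e z j ∧ Yb k l e z j < 1) ∧
      ∀ s, 0 < Θb k l e z s ∧ Θb k l e z s < 1 := by
  obtain ⟨_, _, _, _, _, _, _, _, hXb, hYb, hΘb, -⟩ := H
  refine ⟨fun i => ?_, fun j => ?_, fun s => ?_⟩
  · rw [hXb]; exact hz _
  · rw [hYb]; exact hz _
  · rw [hΘb]; exact hz _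

/-! ### Bounds for the word integrands and the transport `B` -/

include H in
/-- **Bounds for the vertical word integrands** with a nonnegative constant: size, the height
difference `Vt(ξ,η) − Vt(ξ,0) = O(η)` (for `l = 0` both values are `1`, for `l ≥ 1` the second
vanishes), and the Lipschitz bound in the dilation `ξ`. [folklore] -/
theorem qe_Vt_bounds (l : ℕ) : ∃ C : ℝ, 0 ≤ C ∧ ∀ (V : Fin l → Fin (m + 2)) (y : Fin l → ℝ) (ξ η : ℝ),
    (∀ i, 0 ≤ y i ∧ y i ≤ 1) → 0 ≤ ξ → ξ ≤ (α : ℝ) → 0 ≤ η → η ≤ (β : ℝ) →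
      |Vt V y ξ η| ≤ C ∧ |Vt V y ξ η - Vt V y ξ 0| ≤ C * η ∧
        (∀ ξ' : ℝ, 0 ≤ ξ' → ξ' ≤ (α : ℝ) → |Vt V y ξ η - Vt V y ξ' η| ≤ C * η * |ξ - ξ'|) := by
  obtain ⟨_, _, _, _, _, _, _, _, _, _, _, _, hVt_nil, _, _, _, hVt_zero, _, _, _, _, _, _, _, _, _, _, _, _,
    _, _, _, _, _, _, _, _, _, _, _, _, _, _, _, _, _, hbd_Vt⟩ := H
  obtain ⟨C, hC⟩ := hbd_Vt l
  refine ⟨|C|, abs_nonneg C, fun V y ξ η hy hξ hξα hη hηβ => ?_⟩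
  obtain ⟨h1, -, h3, h4⟩ := hC V y ξ η hy hξ hξα hη hηβ
  refine ⟨h1.trans (le_abs_self C), ?_, fun ξ' hξ' hξ'α => (h4 ξ' hξ' hξ'α).trans ?_⟩
  · cases l with
    | zero => rw [hVt_nil, hVt_nil, sub_self, abs_zero]; positivity
    | succ l =>
      rw [hVt_zero, sub_zero]
      exact (h3 l.succ_pos).trans (mul_le_mul_of_nonneg_right (le_abs_self C) hη)
  · exact mul_le_mul_of_nonneg_right (mul_le_mul_of_nonneg_right (le_abs_self C) hη) (abs_nonneg _)

include H in
/-- **Bounds for the horizontal word integrands** with a nonnegative constant: size, and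
`Ht = O(ξ)` in positive length. [folklore] -/
theorem qe_Ht_bounds (k : ℕ) : ∃ C : ℝ, 0 ≤ C ∧ ∀ (U : Fin k → Fin (m + 2)) (x : Fin k → ℝ) (ξ η : ℝ),
    (∀ i, 0 ≤ x i ∧ x i ≤ 1) → 0 ≤ ξ → ξ ≤ (α : ℝ) → 0 ≤ η → η ≤ (β : ℝ) →
      |Ht U x ξ η| ≤ C ∧ (0 < k → |Ht U x ξ η| ≤ C * ξ) := by
  obtain ⟨_, _, _, _, _, _, _, _, _, _, _, _, _, _, _, _, _, _, _, _, _, _, _, _, _, _, _, _, _, _, _, _, _,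
    _, _, _, _, _, _, _, _, _, _, _, _, hbd_Ht, -⟩ := H
  obtain ⟨C, hC⟩ := hbd_Ht k
  refine ⟨|C|, abs_nonneg C, fun U x ξ η hx hξ hξα hη hηβ => ?_⟩
  obtain ⟨h1, -, h3, -⟩ := hC U x ξ η hx hξ hξα hη hηβ
  exact ⟨h1.trans (le_abs_self C), fun hk => (h3 hk).trans (mul_le_mul_of_nonneg_right (le_abs_self C) hξ)⟩

include H in
/-- The height difference of the transport `B`, expanded. [folklore] -/
theorem qe_Bf_sub (ν : (DrinfeldKohnoTrunc ℚ (Fin 4) N) →ₗ[ℚ] ℚ) {k l : ℕ} (x : Fin k → ℝ)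
    (y : Fin l → ℝ) (ξ η η₀ : ℝ) :
    Bf ν x y ξ η - Bf ν x y ξ η₀ = ∑ U : Fin k → Fin (m + 2), ∑ V : Fin l → Fin (m + 2),
      (ν (wZ V * wZ U) : ℝ) * ((Vt V y ξ η - Vt V y ξ η₀) * Ht U x ξ 0) := by
  obtain ⟨_, _, _, _, hBf, -⟩ := H
  rw [hBf, hBf, ← Finset.sum_sub_distrib]
  refine Finset.sum_congr rfl fun U _ => ?_
  rw [← Finset.sum_sub_distrib]
  exact Finset.sum_congr rfl fun V _ => by ring

include H in
/-- **Crude and difference bounds for the transport `B`** paired with an arbitrary functional: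
`|B| ≤ K`, `|B(ξ,η) − B(ξ,0)| ≤ K η`, and `≤ K ξ η` in positive horizontal length. [folklore] -/
theorem qe_Bf_bounds (ν : (DrinfeldKohnoTrunc ℚ (Fin 4) N) →ₗ[ℚ] ℚ) (k l : ℕ) : ∃ K : ℝ, 0 ≤ K ∧
    ∀ (x : Fin k → ℝ) (y : Fin l → ℝ) (ξ η : ℝ), (∀ i, 0 ≤ x i ∧ x i ≤ 1) → (∀ j, 0 ≤ y j ∧ y j ≤ 1) →
      0 ≤ ξ → ξ ≤ (α : ℝ) → 0 ≤ η → η ≤ (β : ℝ) →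
      |Bf ν x y ξ η| ≤ K ∧ |Bf ν x y ξ η - Bf ν x y ξ 0| ≤ K * η ∧
        (0 < k → |Bf ν x y ξ η - Bf ν x y ξ 0| ≤ K * ξ * η) := by
  have hsub := fun (x : Fin k → ℝ) (y : Fin l → ℝ) (ξ η : ℝ) => qe_Bf_sub H ν x y ξ η 0
  obtain ⟨CV, hCV0, hCV⟩ := qe_Vt_bounds H l
  obtain ⟨CH, hCH0, hCH⟩ := qe_Ht_bounds H k
  obtain ⟨_, _, _, _, hBf, -⟩ := H
  refine ⟨(∑ U : Fin k → Fin (m + 2), ∑ V : Fin l → Fin (m + 2), |(ν (wZ V * wZ U) : ℝ)|) * CV * CH,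
    by positivity, fun x y ξ η hx hy hξ hξα hη hηβ => ?_⟩
  have hβ0 : (0 : ℝ) ≤ β := hη.trans hηβ
  have hV := fun V => hCV V y ξ η hy hξ hξα hη hηβ
  have hH := fun U => hCH U x ξ 0 hx hξ hξα le_rfl hβ0
  refine ⟨?_, ?_, fun hk => ?_⟩
  · rw [hBf]
    exact qe_abs_sum_sum_le (fun U V => (ν (wZ V * wZ U) : ℝ)) (fun V => Vt V y ξ η)
      (fun U => Ht U x ξ 0) (fun V => (hV V).1) (fun U => (hH U).1)
  · rw [hsub]
    calc _ ≤ (∑ U : Fin k → Fin (m + 2), ∑ V : Fin l → Fin (m + 2), |(ν (wZ V * wZ U) : ℝ)|) * (CV * η) * CH :=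
          qe_abs_sum_sum_le (fun U V => (ν (wZ V * wZ U) : ℝ)) (fun V => Vt V y ξ η - Vt V y ξ 0)
            (fun U => Ht U x ξ 0) (fun V => (hV V).2.1) (fun U => (hH U).1)
      _ = _ := by ring
  · rw [hsub]
    calc _ ≤ (∑ U : Fin k → Fin (m + 2), ∑ V : Fin l → Fin (m + 2), |(ν (wZ V * wZ U) : ℝ)|) * (CV * η) * (CH * ξ) :=
          qe_abs_sum_sum_le (fun U V => (ν (wZ V * wZ U) : ℝ)) (fun V => Vt V y ξ η - Vt V y ξ 0)
            (fun U => Ht U x ξ 0) (fun V => (hV V).2.1) (fun U => (hH U).2 hk)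
      _ = _ := by ring

/-! ### The delicate case `k = 0`, letter `ℓ`: centrality of `Z_ℓ` against the edge transport -/

include H in
/-- **Centrality at every height `η ∈ [0, β]`**: `Σ_V μ([Z_ℓ, wZ V]) Vt V y 0 η = 0` for `y` in the
open cube (for `η > 0` this is `hcentV`; at `η = 0` every term vanishes). [cite: Drinfeld1991, §2] -/
theorem qe_centralV_zero (μ : (DrinfeldKohnoTrunc ℚ (Fin 4) N) →ₗ[ℚ] ℚ) {l : ℕ} (y : Fin l → ℝ) (η : ℝ)
    (hy : ∀ i, 0 < y i ∧ y i < 1) (hη : 0 ≤ η) (hηβ : η ≤ (β : ℝ)) :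
    ∑ V : Fin l → Fin (m + 2), (μ (op ℓ (wZ V)) : ℝ) * Vt V y 0 η = 0 := by
  have hnil := qe_wZ_nil H
  obtain ⟨_, hop, _, _, _, _, _, _, _, _, _, _, hVt_nil, _, _, _, hVt_zero, _, _, _, _, _, _, hcentV, -⟩ := H
  have hop' : ∀ V : Fin l → Fin (m + 2), op ℓ (wZ V) = 1 * (Zq ℓ * wZ V - wZ V * Zq ℓ) * 1 := fun V => by
    rw [hop, if_pos rfl, one_mul, mul_one]
  simp only [hop']
  rcases hη.eq_or_lt with rfl | hη'
  · cases l with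
    | zero => rw [Fintype.sum_unique]; simp [hnil]
    | succ l => exact Finset.sum_eq_zero fun V _ => by rw [hVt_zero, mul_zero]
  · exact hcentV μ 1 1 y η hy hη' hηβ

include H in
/-- **The transport `B` paired with `μ ∘ ad Z_ℓ` in horizontal length `0` is `O(ξ η)`** on the open
vertical cube: `B(ξ,η) − B(ξ,0) = Σ_V μ([Z_ℓ, wZ V]) (Vt V y ξ η − Vt V y ξ 0)`, the values at `ξ = 0`
summing to zero by centrality, and `Vt` being `η`-Lipschitz in `ξ`. [cite: Drinfeld1991, §2] -/
theorem qe_central_bound (μ : (DrinfeldKohnoTrunc ℚ (Fin 4) N) →ₗ[ℚ] ℚ) (k l : ℕ) (hk : k = 0) :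
    ∃ K : ℝ, 0 ≤ K ∧ ∀ (x : Fin k → ℝ) (y : Fin l → ℝ) (ξ η : ℝ), (∀ j, 0 < y j ∧ y j < 1) →
      0 ≤ ξ → ξ ≤ (α : ℝ) → 0 ≤ η → η ≤ (β : ℝ) →
      |Bf (μ ∘ₗ op ℓ) x y ξ η - Bf (μ ∘ₗ op ℓ) x y ξ 0| ≤ K * ξ * η := by
  subst hk
  have hsub := fun (x : Fin 0 → ℝ) (y : Fin l → ℝ) (ξ η : ℝ) => qe_Bf_sub H (μ ∘ₗ op ℓ) x y ξ η 0
  have hnil := qe_wZ_nil H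
  have hcen := fun (y : Fin l → ℝ) (η : ℝ) => qe_centralV_zero H μ y η
  obtain ⟨CV, hCV0, hCV⟩ := qe_Vt_bounds H l
  obtain ⟨_, _, _, _, _, _, _, _, _, _, _, hHt_nil, -⟩ := H
  refine ⟨(∑ V : Fin l → Fin (m + 2), |(μ (op ℓ (wZ V)) : ℝ)|) * CV, by positivity,
    fun x y ξ η hy hξ hξα hη hηβ => ?_⟩
  have hy' : ∀ i, 0 ≤ y i ∧ y i ≤ 1 := fun i => ⟨(hy i).1.le, (hy i).2.le⟩
  have hβ0 : (0 : ℝ) ≤ β := hη.trans hηβ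
  have hα0 : (0 : ℝ) ≤ α := hξ.trans hξα
  rw [hsub, Fintype.sum_unique]
  simp only [hnil, mul_one, hHt_nil, LinearMap.comp_apply]
  have hsplit : ∑ V : Fin l → Fin (m + 2), (μ (op ℓ (wZ V)) : ℝ) * (Vt V y ξ η - Vt V y ξ 0) =
      ∑ V : Fin l → Fin (m + 2), ((μ (op ℓ (wZ V)) : ℝ) * (Vt V y ξ η - Vt V y 0 η) -
          (μ (op ℓ (wZ V)) : ℝ) * (Vt V y ξ 0 - Vt V y 0 0)) +
        (∑ V : Fin l → Fin (m + 2), (μ (op ℓ (wZ V)) : ℝ) * Vt V y 0 η -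
          ∑ V : Fin l → Fin (m + 2), (μ (op ℓ (wZ V)) : ℝ) * Vt V y 0 0) := by
    rw [← Finset.sum_sub_distrib, ← Finset.sum_add_distrib]
    exact Finset.sum_congr rfl fun V _ => by ring
  rw [hsplit, hcen y η hy hη hηβ, hcen y 0 hy le_rfl hβ0, sub_zero, add_zero]
  calc _ ≤ ∑ V : Fin l → Fin (m + 2), |(μ (op ℓ (wZ V)) : ℝ) * (Vt V y ξ η - Vt V y 0 η) -
          (μ (op ℓ (wZ V)) : ℝ) * (Vt V y ξ 0 - Vt V y 0 0)| := Finset.abs_sum_le_sum_abs _ _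
    _ ≤ ∑ V : Fin l → Fin (m + 2), |(μ (op ℓ (wZ V)) : ℝ)| * (CV * η * ξ) := by
        refine Finset.sum_le_sum fun V _ => (abs_sub _ _).trans ?_
        rw [abs_mul, abs_mul]
        have h1 := (hCV V y ξ η hy' hξ hξα hη hηβ).2.2 0 le_rfl hα0
        have h2 := (hCV V y ξ 0 hy' hξ hξα le_rfl hβ0).2.2 0 le_rfl hα0
        rw [sub_zero, abs_of_nonneg hξ] at h1 h2
        calc _ ≤ |(μ (op ℓ (wZ V)) : ℝ)| * (CV * η * ξ) + |(μ (op ℓ (wZ V)) : ℝ)| * (CV * 0 * ξ) :=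
              add_le_add (mul_le_mul_of_nonneg_left h1 (abs_nonneg _))
                (mul_le_mul_of_nonneg_left h2 (abs_nonneg _))
          _ = _ := by ring
    _ = _ := by rw [← Finset.sum_mul]; ring

include H in
/-- **Master bound for Step A** (`x` closed, `y` open, `0 < ξ ≤ α`, `η, η' ∈ [0, β]`): the weighted
height difference `fd_a(ξ,η') [B^{μ∘op a}(ξ,η) − B^{μ∘op a}(ξ,0)]` and the difference
`fd_a(ξ,η) B(ξ,η) − fd_a(ξ,0) B(ξ,0)` are both `O(η)`, uniformly (the letter `ℓ` carries the weight
`1/ξ`, absorbed by `B = O(ξ)`: `Ht = O(ξ)` for `k ≥ 1`, centrality for `k = 0`). [cite: Drinfeld1991, §2] -/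
theorem qe_master_bound (μ : (DrinfeldKohnoTrunc ℚ (Fin 4) N) →ₗ[ℚ] ℚ) (k l : ℕ) : ∃ K : ℝ, 0 ≤ K ∧
    ∀ (a : Fin (m + 2)) (x : Fin k → ℝ) (y : Fin l → ℝ) (ξ η η' : ℝ), (∀ i, 0 ≤ x i ∧ x i ≤ 1) →
      (∀ j, 0 < y j ∧ y j < 1) → 0 < ξ → ξ ≤ (α : ℝ) → 0 ≤ η → η ≤ (β : ℝ) → 0 ≤ η' → η' ≤ (β : ℝ) →
      |fd a ξ η'| * |Bf (μ ∘ₗ op a) x y ξ η - Bf (μ ∘ₗ op a) x y ξ 0| ≤ K * η ∧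
      |fd a ξ η * Bf (μ ∘ₗ op a) x y ξ η - fd a ξ 0 * Bf (μ ∘ₗ op a) x y ξ 0| ≤ K * η := by
  choose K₁ hK₁0 hK₁ using fun a : Fin (m + 2) => qe_Bf_bounds H (μ ∘ₗ op a) k l
  have hc : ∃ K₂ : ℝ, 0 ≤ K₂ ∧ ∀ (_ : k = 0) (x : Fin k → ℝ) (y : Fin l → ℝ) (ξ η : ℝ),
      (∀ j, 0 < y j ∧ y j < 1) → 0 ≤ ξ → ξ ≤ (α : ℝ) → 0 ≤ η → η ≤ (β : ℝ) →
      |Bf (μ ∘ₗ op ℓ) x y ξ η - Bf (μ ∘ₗ op ℓ) x y ξ 0| ≤ K₂ * ξ * η := by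
    rcases Nat.eq_zero_or_pos k with hk | hk
    · obtain ⟨K₂, h0, h⟩ := qe_central_bound H μ k l hk
      exact ⟨K₂, h0, fun _ => h⟩
    · exact ⟨0, le_rfl, fun h => absurd h hk.ne'⟩
  obtain ⟨K₂, hK₂0, hK₂⟩ := hc
  obtain ⟨_, _, _, _, _, _, _, _, _, _, _, _, _, _, _, _, _, hfd_reg, _, _, _, _, _, _, _, _, _, _, _, _, _, _,
    _, _, _, _, _, _, _, _, _, _, _, _, hbd_letters, -⟩ := H
  obtain ⟨CL, hCL⟩ := hbd_letters
  set S : ℝ := ∑ a : Fin (m + 2), K₁ a with hS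
  have hS0 : 0 ≤ S := Finset.sum_nonneg fun a _ => hK₁0 a
  have hSa : ∀ a, K₁ a ≤ S := fun a => Finset.single_le_sum (fun a _ => hK₁0 a) (Finset.mem_univ a)
  refine ⟨2 * |CL| * S + S + K₂, by positivity, fun a x y ξ η η' hx hy hξ hξα hη hηβ hη' hη'β => ?_⟩
  have hy' : ∀ j, 0 ≤ y j ∧ y j ≤ 1 := fun j => ⟨(hy j).1.le, (hy j).2.le⟩
  obtain ⟨hB, hBd, hBdk⟩ := hK₁ a x y ξ η hx hy' hξ.le hξα hη hηβ
  -- (1) the weighted height difference, for any admissible second argument of the weight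
  have h1 : ∀ η'' : ℝ, 0 ≤ η'' → η'' ≤ (β : ℝ) →
      |fd a ξ η''| * |Bf (μ ∘ₗ op a) x y ξ η - Bf (μ ∘ₗ op a) x y ξ 0| ≤ (|CL| * S + S + K₂) * η := by
    intro η'' hη'' hη''β
    by_cases ha : a = ℓ
    · have hfd' : fd a ξ η'' = 1 / ξ := by rw [ha, hfd_reg]
      rw [hfd', abs_of_pos (one_div_pos.2 hξ), one_div, inv_mul_le_iff₀ hξ]
      rcases Nat.eq_zero_or_pos k with hk | hk
      · rw [ha]
        calc _ ≤ K₂ * ξ * η := hK₂ hk x y ξ η hy hξ.le hξα hη hηβ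
          _ ≤ ξ * ((|CL| * S + S + K₂) * η) := by
            nlinarith [mul_nonneg (mul_nonneg hξ.le hη) hS0,
              mul_nonneg (mul_nonneg (mul_nonneg hξ.le hη) hS0) (abs_nonneg CL)]
      · calc _ ≤ K₁ a * ξ * η := hBdk hk
          _ ≤ ξ * ((|CL| * S + S + K₂) * η) := by
            nlinarith [mul_nonneg (mul_nonneg hξ.le hη) hK₂0,
              mul_nonneg (mul_nonneg (mul_nonneg hξ.le hη) hS0) (abs_nonneg CL),
              mul_nonneg (mul_nonneg hξ.le hη) (sub_nonneg.2 (hSa a))]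
    · have hfd : |fd a ξ η''| ≤ |CL| := ((hCL a ξ η'' hξ.le hξα hη'' hη''β).1 ha).trans (le_abs_self CL)
      calc _ ≤ |CL| * (K₁ a * η) := mul_le_mul hfd hBd (abs_nonneg _) (abs_nonneg _)
        _ ≤ (|CL| * S + S + K₂) * η := by
            nlinarith [mul_nonneg (abs_nonneg CL) (mul_nonneg (sub_nonneg.2 (hSa a)) hη),
              mul_nonneg hS0 hη, mul_nonneg hK₂0 hη]
  refine ⟨(h1 η' hη' hη'β).trans (by nlinarith [mul_nonneg (mul_nonneg (abs_nonneg CL) hS0) hη]), ?_⟩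
  -- (2) the difference `fd(η) B(η) − fd(0) B(0)`
  have hβ0 : (0 : ℝ) ≤ β := hη.trans hηβ
  have hL : |fd a ξ η - fd a ξ 0| ≤ |CL| * η := by
    have := (hCL a ξ η hξ.le hξα hη hηβ).2.2.2.1 0 le_rfl hβ0
    rw [sub_zero, abs_of_nonneg hη] at this
    exact this.trans (mul_le_mul_of_nonneg_right (le_abs_self CL) hη)
  have hsplit : fd a ξ η * Bf (μ ∘ₗ op a) x y ξ η - fd a ξ 0 * Bf (μ ∘ₗ op a) x y ξ 0 =
      (fd a ξ η - fd a ξ 0) * Bf (μ ∘ₗ op a) x y ξ η +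
        fd a ξ 0 * (Bf (μ ∘ₗ op a) x y ξ η - Bf (μ ∘ₗ op a) x y ξ 0) := by ring
  rw [hsplit]
  calc _ ≤ |(fd a ξ η - fd a ξ 0) * Bf (μ ∘ₗ op a) x y ξ η| +
        |fd a ξ 0 * (Bf (μ ∘ₗ op a) x y ξ η - Bf (μ ∘ₗ op a) x y ξ 0)| := abs_add_le _ _
    _ ≤ |CL| * η * K₁ a + (|CL| * S + S + K₂) * η := by
        rw [abs_mul, abs_mul]
        exact add_le_add (mul_le_mul hL hB (abs_nonneg _) (by positivity)) (h1 0 le_rfl hβ0)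
    _ ≤ _ := by nlinarith [mul_nonneg (mul_nonneg (abs_nonneg CL) hη) (sub_nonneg.2 (hSa a))]

end AbstractEngine

/-- **Hook `cornerEngineQE_abs_sum_sum_le`** (registered form of `qe_abs_sum_sum_le`): a weighted double sum is
bounded by the total mass of its coefficients times the bounds of the two factors. [folklore] -/
theorem cornerEngineQE_abs_sum_sum_le : ∀ (ι κ : Type) [Fintype ι] [Fintype κ] (c : ι → κ → ℝ) (f : κ → ℝ) (g : ι → ℝ) (B₁ B₂ : ℝ), (∀ V, |f V| ≤ B₁) → (∀ U, |g U| ≤ B₂) → |∑ U, ∑ V, c U V * (f V * g U)| ≤ (∑ U, ∑ V, |c U V|) * B₁ * B₂ :=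
  fun _ _ _ _ c f g _ _ hf hg => qe_abs_sum_sum_le c f g hf hg

end Summit.KontsevichZagierPeriods.FurushoPentagon.PentagonInKZ
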